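import Summits.ResolutionOfSingularities.ResolutionOfSingularities.Theorems.MarkedTransferCampaignG1PnegaObligationF33StdNarasimhanCells
import HarnessLib

/-!
# [OURS · L1 G1 ℘nega-INTERFACE / RESCUE bed-type datum] The Narasimhan `H♭`-data, PART C: the full §9.7 RUN under the «restart at the new
# frontier» reading — step 2 (this file) and step 3 (PART D `…NarasimhanRun`) (`ϵ(1) = z w³ + x⁷ w`, Case (I), `H♭ = x⁷ w`, degree `−4`, order clause VIOLATED; `ϵ(2) = z w³`, Case (III),
# `H♭ = z w³`, degree `−2`, order clause met; `ϵ(3) = 0`), the strict lexicographic DESCENT of the top pair `e_x+e_z > e_x+e_w > e_z+e_w`, and the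
# slot demands of the run. By res-type-063 (gen 7); PARTS A/B = `…F33StdNarasimhan` / `…F33StdNarasimhanCells`; carried by res-L1-type-o6.

CARRIER NOTE (res-L1-type-o6 g20): KERNEL by res-type-063 (HOME draft `D/res-type-063/PnegaObligationF33StdNarasimhanStep2.draft.lean` sha16
1fd542f3a1be9e77, DRAFT READY + CARRY ask extension 2026-08-27T07:20:42Z, TAKING 07:37Z; PART C of the carry order A p509255 / B p510211 / C / D),
summit-side VERBATIM (this note and the by-line clause added). [OURS · L1 G1] replaces the role of: nothing printed beyond what the decl
docstrings cite — the OURS objects of STEP 2 of the Narasimhan run (`eps₁ = ϵ(1)`, `head₁`, the standard expression `stdExpr₁` with its frontier data, the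
`HFlatDatum` `datum₁` at a GENERIC placement) and the data-level kernels about them (value `x⁷w`, degree `−4`, Case (I) only, order clause
violated, slot demand); bed-type DATA for the retyped obligation F3.3 under the RESCUE-SEED O-102 «restart» reading, no printed item; NOT a statement of the manuscript.
HONEST FRAMING. Nothing here is a statement of H. Hironaka's manuscript *Resolution of singularities in positive characteristics*
(2017-03-23, [Hironaka2017], lit key `paper:url-3343fd9e678b`; every printed item is a CANDIDATE [claim: Hironaka2017, status:
under-review]). The data are OURS instances of the printed recipe (`PnegaObligation.HFlatDatum`, p496649) at the GENERIC placement `P ∋` head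
in degree `2`; the «restart» reading (after the top block is exhausted, re-expand `ϵ(i)` and apply Def. 9.12 to its new top data) is the
RESCUE-SEED O-102 reading of Rem. 9.13 (2) (res-plan-2 / res-adj-2), NOT a printed sentence. AI kernel work, weaker than expert review;
nothing here is progress on resolution of singularities in positive characteristic; no verdict on any printed statement.

## The run (char 2, `q = 2`, `y = X 0`; PART B: `ϵ(0) = xz³ + zw³ + x⁷w`, `H♭(ϵ(0)) = xz³`)
* STEP 2: `ϵ(1) = z w³ + x⁷ w` (`ord = 4`), head `g₁ = y² + ϵ(1)` (requires `g₁ ∈ P 2`, i.e. `x z³ ∈ P 2` beyond `g ∈ P 2` — hypothesis `hg₁`).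
  Standard expression `{(e_z+e_w,0,e_w), (e_x+e_w,0,3e_x)}`; top pair `α₁ = e_x+e_w` (`(0,1,0,1) >lex (0,0,1,1)`), `β₁ = 0`, `γ = 3e_x`, `u = 1`;
  `|α₁| = 2 = q`, `|qγ| = 6 ≥ 2q`: Case (I) ONLY. Rem. 9.9: `H♭ = u⁻¹ Δ_{(0,1,0,1)}ϵ(1)·Δ_{(0,6,0,0)}ϵ(1) = x⁶ · x w = x⁷ w` (`C(7,1) = C(7,6) = 7 ≡ 1`);
  `−δ(A,I,0) = 2q − |α₁+qγ| = 4 − 8 = −4`. ORDER clause: `ord ϵ(1) = 4 ≠ 8` — VIOLATED (`not_order_clause₁`): this step is outside the scope of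
  the ORDER reading `F33stdOrd` but inside «II-first»/as printed (Case (I) outside (II): unit-free, `x⁷w ∈ 𝔪⁸`).
* STEP 3: `ϵ(2) = ϵ(1) − x⁷w = z w³`, head `g₂ = y² + z w³` (hypothesis `hg₂ : g₂ ∈ P 2`). One term `(e_z+e_w, 0, e_w)`; `α₂ = e_z+e_w`, `γ = e_w`;
  Case (III) only; `h♭ = Δ_{(0,0,1,1)}·Δ_{(0,0,0,2)}`, `h♭(zw³) = w²·zw = zw³` (fixed), `k̄ = 2`, `H♭ = z w³`, degree `−2`, order clause met;
  `ϵ(3) = 0`: the run TERMINATES, `ϵ(0) = H♭₀ + H♭₁ + H♭₂` (`run_sum`).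
* DESCENT: `toLex (e_z+e_w) < toLex (e_x+e_w) < toLex (e_x+e_z)` — the top pair drops strictly at every step (`topPair_descent`).
* SLOT DEMANDS of the run on a candidate `℘nega`: `xz³ ∈ (−2)`, `x⁷w ∈ (−4)`, `zw³ ∈ (−2)`. SW (class regime `e' = 1`, `m = 2`): steps 1 and 3 ✓ at
  every placement (`Δ_{e_x+e_z} g = z²`, PART B; `Δ_{e_z+e_w} g₂ = w²`, `value₂_mem_sandwichPNega`); step 2 (`x⁷w ∈ ℘nega_sw(−4)`) is NOT
  decided here (its sources are `P(2d)`, `d ≥ 2`, which a generic `P` does not control).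
-/

noncomputable section

set_option linter.dupNamespace false -- mandated namespace of this single-conjunct summit

namespace Summit.ResolutionOfSingularities.ResolutionOfSingularities.Theorems.Campaign.PnegaObligation.NarasimhanDatum

open Literature.AlgebraicGeometry.Hironaka2017 Literature.AlgebraicGeometry.Hironaka2017.S09LLUED
open Literature.AlgebraicGeometry.Hironaka2017.S08UnitMonomial (StandardExpression U46_3_ours)
open Literature.RingTheory.MvPowerSeries (hasseDeriv adicOrder_eq_order)
open Literature.AlgebraicGeometry.Resolution (adicOrder)
open MvPowerSeries (X monomial coeff)

universe u

variable (K : Type u) [Field K]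

/-! ## §1 Step 2: `ϵ(1) = z w³ + x⁷ w`, Case (I), `H♭ = x⁷ w`, degree `−4` -/

/-- `ϵ(1) = z w³ + x⁷ w`. [folklore] -/
def eps₁ : MvPowerSeries (Fin 4) K := monomial (nu 0 0 1 3) 1 + monomial (nu 0 7 0 1) 1

/-- `g₁ = y² + ϵ(1)`. [folklore] -/
def head₁ : MvPowerSeries (Fin 4) K := X 0 ^ 2 + eps₁ K

/-- `ϵ(1) = ϵ(0) − H♭(ϵ(0))` (PART B `eps_sub_value`). [folklore] -/
theorem eps₁_eq_sub [CharP K 2] (P : ℕ → Ideal (MvPowerSeries (Fin 4) K)) (hg : head K ∈ P 2) :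
    eps₁ K = eps K - (datum K P hg).value := by rw [eps_sub_value]; rfl

open Classical in
/-- Coefficients of `ϵ(1)`. [folklore] -/
theorem coeff_eps₁ (m : Fin 4 →₀ ℕ) : coeff m (eps₁ K) = (if m = nu 0 0 1 3 then 1 else 0) + (if m = nu 0 7 0 1 then 1 else 0) := by
  simp only [eps₁, map_add, MvPowerSeries.coeff_monomial]

/-- `ord ϵ(1) = 4`. [folklore] -/
theorem order_eps₁ : (eps₁ K).order = (4 : ℕ) := by
  classical
  apply le_antisymm
  · have h := MvPowerSeries.order_le (f := eps₁ K) (d := nu 0 0 1 3) (by rw [coeff_eps₁, if_pos rfl, if_neg] <;> simp [nu_eq_iff])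
    simpa [degree_nu] using h
  · refine MvPowerSeries.nat_le_order fun d hd => ?_
    rw [coeff_eps₁, if_neg, if_neg, add_zero] <;> rintro rfl <;> rw [degree_nu] at hd <;> omega

/-- `ord g₁ = 2`. [folklore] -/
theorem order_head₁ : (head₁ K).order = (2 : ℕ) := by
  have hne : ((X 0 : MvPowerSeries (Fin 4) K) ^ 2).order ≠ (eps₁ K).order := by
    rw [order_X0_sq, order_eps₁]; exact_mod_cast (show (2 : ℕ) ≠ 4 by omega)
  rw [head₁, MvPowerSeries.order_add_of_order_ne hne, order_X0_sq, order_eps₁]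
  exact inf_eq_left.mpr (by exact_mod_cast (show (2 : ℕ) ≤ 4 by omega))

/-- The two-term standard expression of `ϵ(1)` (terms `t₂`, `t₃` of PART A). [folklore] -/
def stdExpr₁ (ℓ : ℕ) : StandardExpression 2 (X : Fin 4 → MvPowerSeries (Fin 4) K) 1 ℓ (eps₁ K) where
  support := {t₂, t₃}
  u := fun _ => 1
  u_mem := fun _ _ => ⟨1, one_pow _⟩
  u_unit_or_zero := fun _ _ => Or.inl isUnit_one
  a_lt := by
    intro t ht i
    simp only [Finset.mem_insert, Finset.mem_singleton] at ht
    rcases ht with rfl | rfl <;> fin_cases i <;> simp [t₂, t₃]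
  b_lt := by
    intro t ht j
    simp only [Finset.mem_insert, Finset.mem_singleton] at ht
    rcases ht with rfl | rfl <;> simp [t₂, t₃]
  sum_eq := by
    rw [Finset.sum_insert (by simp only [Finset.mem_singleton]; exact t₂_ne_t₃), Finset.sum_singleton, mul_one, mul_one]
    show eps₁ K = _ + _
    rw [term_eq, term_eq]
    show eps₁ K = monomial (nu 0 0 1 1 + 2 • (0 : Fin 4 →₀ ℕ) + 2 ^ 1 • nu 0 0 0 1) 1 + monomial (nu 0 1 0 1 + 2 • (0 : Fin 4 →₀ ℕ) + 2 ^ 1 • nu 0 3 0 0) 1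
    rw [t₂_exp, t₃_exp]; rfl

variable (ℓ : ℕ)

/-- Both coefficients are non-zero. [folklore] -/
theorem effSupport₁_eq : TopFrontier.effSupport (stdExpr₁ K ℓ).support (stdExpr₁ K ℓ).u = {t₂, t₃} :=
  TopFrontier.effSupport_eq_self _ _ fun _ _ => one_ne_zero

/-- `(0,0,1,1) <lex (0,1,0,1)`. [folklore] -/
theorem toLex_a₂_lt_a₃ : toLex (nu 0 0 1 1) < toLex (nu 0 1 0 1) :=
  Finsupp.Lex.lt_iff.mpr ⟨1, fun j hj => by fin_cases j <;> simp at hj ⊢, by simp⟩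

/-- `t₃` carries the lexicographically largest pair. [folklore] -/
theorem isGreatest_t₃ : ∀ s ∈ TopFrontier.effSupport (stdExpr₁ K ℓ).support (stdExpr₁ K ℓ).u, TopFrontier.pairKey s ≤ TopFrontier.pairKey t₃ := by
  intro s hs
  rw [effSupport₁_eq] at hs
  simp only [Finset.mem_insert, Finset.mem_singleton] at hs
  rcases hs with rfl | rfl
  · exact Prod.Lex.toLex_le_toLex.mpr (Or.inl toLex_a₂_lt_a₃)
  · exact le_rfl

/-- The top term is present. [folklore] -/
theorem t₃_mem : t₃ ∈ TopFrontier.effSupport (stdExpr₁ K ℓ).support (stdExpr₁ K ℓ).u := by rw [effSupport₁_eq]; simp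

/-- `α₁ = e_x + e_w`. [folklore] -/
theorem alpha₁_eq : TopFrontier.alpha (stdExpr₁ K ℓ).support (stdExpr₁ K ℓ).u = nu 0 1 0 1 :=
  TopFrontier.alpha_eq_of_isGreatest _ _ (t₃_mem K ℓ) (isGreatest_t₃ K ℓ)
/-- `β₁ = 0`. [folklore] -/
theorem beta₁_eq : TopFrontier.beta (stdExpr₁ K ℓ).support (stdExpr₁ K ℓ).u = 0 :=
  TopFrontier.beta_eq_of_isGreatest _ _ (t₃_mem K ℓ) (isGreatest_t₃ K ℓ)
/-- `m + 1 ≥ 1`. [folklore] -/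
theorem frontierLength₁_pos : 0 < TopFrontier.frontierLength (stdExpr₁ K ℓ).support (stdExpr₁ K ℓ).u :=
  (TopFrontier.frontierLength_pos_iff _ _).2 ⟨_, t₃_mem K ℓ⟩
/-- `γ = 3e_x`. [folklore] -/
theorem gamma₁_zero_eq : TopFrontier.gamma (stdExpr₁ K ℓ).support (stdExpr₁ K ℓ).u ⟨0, frontierLength₁_pos K ℓ⟩ = nu 0 3 0 0 := by
  have hmem := TopFrontier.gamma_mem_effSupport (T := (stdExpr₁ K ℓ).support) (u := (stdExpr₁ K ℓ).u) ⟨0, frontierLength₁_pos K ℓ⟩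
  rw [alpha₁_eq, beta₁_eq, effSupport₁_eq, Finset.mem_insert, Finset.mem_singleton] at hmem
  rcases hmem with h | h
  · have := congrArg (fun t : TopFrontier.ExpTriple 4 => t.1 1) h
    simp [t₂] at this
  · simpa [t₃] using congrArg (fun t : TopFrontier.ExpTriple 4 => t.2.2) h
/-- `u = 1`. [folklore] -/
theorem u0₁_eq : StdExpr76.u0 (stdExpr₁ K ℓ).support (stdExpr₁ K ℓ).u = 1 := by
  unfold StdExpr76.u0; rw [dif_pos (frontierLength₁_pos K ℓ)]; rfl

/-- §8.3 for `(g₁, ϵ(1), y)`. [folklore] -/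
theorem std₁ (P : ℕ → Ideal (MvPowerSeries (Fin 4) K)) (hg₁ : head₁ K ∈ P 2) :
    U46_3_ours 2 (X : Fin 4 → MvPowerSeries (Fin 4) K) (fun f => f ∈ P (2 ^ 1)) 1 (head₁ K) (eps₁ K) (X 0) where
  y_mem := ⟨0, rfl⟩
  y_pow_eq := by rw [pow_one]; exact (add_sub_cancel_right _ _).symm
  ord_g := by rw [adicOrder_eq_order, order_head₁]; norm_num
  ord_lt := by rw [adicOrder_eq_order, order_eps₁]; exact_mod_cast (show 2 ^ 1 < 4 by norm_num)
  mem52 := by rw [pow_one]; exact hg₁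

/-- **The step-2 datum**: `ϵ(1) = zw³ + x⁷w`, Case (I) of Lem. 9.6 (`|qγ| = 6 ≥ 2q`), depth `9 > |α₁+qγ| = 8`. [folklore] -/
def datum₁ (P : ℕ → Ideal (MvPowerSeries (Fin 4) K)) (hg₁ : head₁ K ∈ P 2) : HFlatDatum 2 K 4 P where
  e := 1
  e_pos := one_pos
  depth := 9
  i₀ := 0
  g := head₁ K
  ε0 := eps₁ K
  S := stdExpr₁ K 9
  std := std₁ K P hg₁
  frontier_pos := frontierLength₁_pos K _
  u0_isUnit := by rw [u0₁_eq]; exact isUnit_one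
  alpha_ne_zero := by rw [alpha₁_eq]; exact fun h => by simpa using DFunLike.congr_fun h 1
  q_lt_depth := by norm_num
  degree_lt_depth := by
    rw [alpha₁_eq, beta₁_eq, gamma₁_zero_eq, t₃_exp, degree_nu]; norm_num
  clean₁ := by rw [alpha₁_eq, beta₁_eq, smul_zero, add_zero, head₁, map_add, hasseDeriv_nu_X0_sq K (by norm_num), zero_add]
  clean₂ := by
    have h6 : 2 ^ 1 • nu 0 3 0 0 = nu 0 6 0 0 := by ext i; fin_cases i <;> simp
    rw [gamma₁_zero_eq, h6, head₁, map_add, hasseDeriv_nu_X0_sq K (by norm_num), zero_add]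
  case := HFlat.Case.I (by
    show 2 * 2 ^ 1 ≤ (2 ^ 1 • TopFrontier.gamma _ _ _).degree
    rw [gamma₁_zero_eq, show 2 ^ 1 • nu 0 3 0 0 = nu 0 6 0 0 by ext i; fin_cases i <;> simp, degree_nu]; norm_num)

variable (P : ℕ → Ideal (MvPowerSeries (Fin 4) K)) (hg₁ : head₁ K ∈ P 2)

/-- `α₁`. [folklore] -/
theorem datum₁_alpha : (datum₁ K P hg₁).α = nu 0 1 0 1 := alpha₁_eq K _
/-- `β₁ = 0`. [folklore] -/
theorem datum₁_beta : (datum₁ K P hg₁).β = 0 := beta₁_eq K _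
/-- `γ = 3e_x`. [folklore] -/
theorem datum₁_gamma : (datum₁ K P hg₁).γ₀ = nu 0 3 0 0 := gamma₁_zero_eq K _
/-- `q = 2`. [folklore] -/
theorem datum₁_q : (datum₁ K P hg₁).q = 2 := rfl
/-- `u = 1`. [folklore] -/
theorem datum₁_u0 : (datum₁ K P hg₁).u₀ = 1 := Units.ext (by show StdExpr76.u0 (stdExpr₁ K 9).support (stdExpr₁ K 9).u = 1; exact u0₁_eq K 9)
/-- `α₁ + pβ₁ + qγ = (0,7,0,1)`. [folklore] -/
theorem datum₁_exps : (datum₁ K P hg₁).α + 2 • (datum₁ K P hg₁).β + (datum₁ K P hg₁).q • (datum₁ K P hg₁).γ₀ = nu 0 7 0 1 := by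
  rw [datum₁_alpha, datum₁_beta, datum₁_gamma, datum₁_q]; ext i; fin_cases i <;> simp

/-- Case (II) fails at step 2 (`|α₁| = 2`), so every selection policy returns Case (I) or the witness given. [folklore] -/
theorem not_isCaseII₁ : ¬ IsCaseII 2 (datum₁ K P hg₁).q (datum₁ K P hg₁).α (datum₁ K P hg₁).β := by
  unfold IsCaseII; rw [datum₁_alpha, datum₁_beta, datum₁_q, smul_zero, add_zero, degree_nu]; omega
/-- Case (III) fails at step 2 (`|qγ| = 6 ≠ q`). [folklore] -/
theorem not_isCaseIII₁ : ¬ IsCaseIII 2 (datum₁ K P hg₁).q (datum₁ K P hg₁).α (datum₁ K P hg₁).β (datum₁ K P hg₁).γ₀ := by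
  rintro ⟨-, -, h, -⟩
  rw [datum₁_gamma, datum₁_q, show 2 • nu 0 3 0 0 = nu 0 6 0 0 by ext i; fin_cases i <;> simp, degree_nu] at h
  omega
/-- Every case witness at step 2 is Case (I). [folklore] -/
theorem case₁_eq (c : HFlat.Case 2 (datum₁ K P hg₁).q (datum₁ K P hg₁).α (datum₁ K P hg₁).β (datum₁ K P hg₁).γ₀) : ∃ h, c = HFlat.Case.I h := by
  rcases c with h | h | h
  · exact ⟨h, rfl⟩
  · exact absurd h (not_isCaseII₁ K P hg₁)
  · exact absurd h (not_isCaseIII₁ K P hg₁)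

section CharTwo
variable [CharP K 2]

/-- `(7 : K) = 1` in characteristic `2`. [folklore] -/
theorem seven_eq_one : (7 : K) = 1 := by
  have h : ((7 : ℕ) : K) = 1 := by
    rw [show (7 : ℕ) = 2 * 3 + 1 from rfl, Nat.cast_add, Nat.cast_mul, CharP.cast_eq_zero K 2, zero_mul, zero_add, Nat.cast_one]
  exact_mod_cast h

/-- `Δ_{(0,1,0,1)} ϵ(1) = x⁶` (`C(7,1) = 7 ≡ 1`; `zw³` has no `x`). [folklore] -/
theorem hasseDeriv_alpha_eps₁ : hasseDeriv (nu 0 1 0 1) (eps₁ K) = monomial (nu 0 6 0 0) (1 : K) := by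
  have hsub : nu 0 7 0 1 - nu 0 1 0 1 = nu 0 6 0 0 := by ext i; fin_cases i <;> simp
  rw [eps₁, map_add, hasseDeriv_monomial_of_not_le K (by rw [nu_le_nu_iff]; omega), hasseDeriv_monomial_of_le K (nu_le_nu_iff.mpr (by omega)),
    zero_add, hsub, Fin.prod_univ_four]
  simp [seven_eq_one K]

/-- `Δ_{(0,6,0,0)} ϵ(1) = x w` (`C(7,6) = 7 ≡ 1`). [folklore] -/
theorem hasseDeriv_qgamma_eps₁ : hasseDeriv (nu 0 6 0 0) (eps₁ K) = monomial (nu 0 1 0 1) (1 : K) := by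
  have hsub : nu 0 7 0 1 - nu 0 6 0 0 = nu 0 1 0 1 := by ext i; fin_cases i <;> simp
  rw [eps₁, map_add, hasseDeriv_monomial_of_not_le K (by rw [nu_le_nu_iff]; omega), hasseDeriv_monomial_of_le K (nu_le_nu_iff.mpr (by omega)),
    zero_add, hsub, Fin.prod_univ_four]
  simp [seven_eq_one K]

/-- **`H♭(ϵ(1)) = x⁶ · x w = x⁷ w`** (Rem. 9.9, Case (I), `u = 1`). [folklore] -/
theorem datum₁_value : (datum₁ K P hg₁).value = monomial (nu 0 7 0 1) (1 : K) := by
  obtain ⟨hI, hc⟩ := case₁_eq K P hg₁ (datum₁ K P hg₁).case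
  have h6 : 2 • nu 0 3 0 0 = nu 0 6 0 0 := by ext i; fin_cases i <;> simp
  have h7 : nu 0 6 0 0 + nu 0 1 0 1 = nu 0 7 0 1 := by ext i; fin_cases i <;> simp
  unfold HFlatDatum.value
  rw [hc]
  show HFlat.caseI (hasseFamily K 4) (datum₁ K P hg₁).u₀ 2 (datum₁ K P hg₁).q (datum₁ K P hg₁).α (datum₁ K P hg₁).β (datum₁ K P hg₁).γ₀ (eps₁ K) = _
  unfold HFlat.caseI hasseFamily
  rw [datum₁_alpha, datum₁_beta, datum₁_gamma, datum₁_q, datum₁_u0, smul_zero, add_zero, h6, hasseDeriv_alpha_eps₁, hasseDeriv_qgamma_eps₁,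
    inv_one, Units.val_one, one_mul, MvPowerSeries.monomial_mul_monomial, mul_one, h7]

end CharTwo

/-- **`−δ(A,I,0) = 2q − |α₁+pβ₁+qγ| = 4 − 8 = −4`.** [folklore] -/
theorem datum₁_degree : (datum₁ K P hg₁).degree = -4 := by
  obtain ⟨hI, hc⟩ := case₁_eq K P hg₁ (datum₁ K P hg₁).case
  unfold HFlatDatum.degree
  rw [hc]
  show HFlat.negDeltaAI 2 (datum₁ K P hg₁).q (datum₁ K P hg₁).α (datum₁ K P hg₁).β (datum₁ K P hg₁).γ₀ = -4
  unfold HFlat.negDeltaAI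
  rw [datum₁_exps, degree_nu, datum₁_q]; norm_num

/-- **Step 2 VIOLATES the order clause** of the reading of record: `ord ϵ(1) = 4 ≠ 8 = |α₁ + pβ₁ + qγ|` — the ORDER column `F33stdOrd` does not
constrain this step; «II-first»/as-printed do (Case (I) outside (II): unit-free by `HFlatDatum.value_mem_maximalIdeal_of_not_isCaseII`). [folklore] -/
theorem not_order_clause₁ :
    adicOrder (datum₁ K P hg₁).ε0 ≠ (((datum₁ K P hg₁).α + 2 • (datum₁ K P hg₁).β + (datum₁ K P hg₁).q • (datum₁ K P hg₁).γ₀).degree : ℕ∞) := by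
  rw [datum₁_exps, degree_nu, show (datum₁ K P hg₁).ε0 = eps₁ K from rfl, adicOrder_eq_order, order_eps₁]
  exact_mod_cast (show (4 : ℕ) ≠ 0 + 7 + 0 + 1 by omega)

end Summit.ResolutionOfSingularities.ResolutionOfSingularities.Theorems.Campaign.PnegaObligation.NarasimhanDatum
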